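import Literature.Computability.AlgebraicComplexity.RectangularExponentLaserCertificate
import Literature.Computability.AlgebraicComplexity.LaserDegenerationBound
import Literature.Barriers.MatrixMultiplication.RectangularBarrier
import HarnessLib

/-!
# Dupont et al. 2026, `ω < 2.371177` (arXiv:2608.16884v1): the record's hypotheses in the tree's
currencies — proved reductions, no named fact

Topic `Literature/Computability/AlgebraicComplexity`; companion of `RectangularExponent.lean`
(`advxxz2025_omega_le : omega ℂ ≤ 2.371339`, the refereed record of Alman–Duan–Vassilevska Williams–
Xu–Xu–Zhou, SODA 2025) and of `RectangularExponentSquareRecord.lean` /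
`VXXZ2024AlgorithmOutput.lean` (the same reductions for `2.371339` and `2.371552`).

E. Dupont, M. Eisenberger, B. Kozlovskii, A. Mehrabian, F. J. R. Ruiz, A. See, R. Zhou, J. Alman,
V. Vassilevska Williams, M. Balog, *Improving the matrix multiplication exponent with modern
optimization and AlphaEvolve*, arXiv:2608.16884v1 (17 Aug 2026), announce **`ω < 2.371177`**
(abstract, p. 1; §5, p. 10).  The printed argument is: the optimisation problem (11) of §2.4 (p. 8),
"minimize `Ω` subject to `E_total + M_total · Ω ≥ 2^{ℓ*−1} log(q+2)`", is — by their Theorem 1,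
quoted from Alman et al. 2025 — such that "any feasible solution of Equation (11) implies `ω ≤ Ω`";
the note exhibits (numerically: JAX gradient descent + AlphaEvolve, §3) a feasible point at `q = 5`,
`ℓ* = 4` (≈ 7·10⁶ parameters, p. 9) with `Ω = 2.371177`, verified in exact rational arithmetic (§4,
p. 10; "We are preparing a repository in which we will release the verification code and our
discovered solution").  In the tree's terms this is the SAME pipeline as the 2024/2025 records on the
SAME tensor `CW_5` (one analysis level higher, budget `7^8` instead of `7^4`): a laser-method
degeneration of copies of `CW_5^{⊗N}` into independent matrix products, consumed by Schönhage's
asymptotic sum inequality and `R̃(CW_5) ≤ 7` — both PROVED in the tree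
(`omegaRect_le_of_cw5DegenerationCertificate`, `omega_le_of_forall_polyDegeneratesTo`).

This file records, as PROVED implications and nothing else (no definition, no named fact: the
announced bound is an arXiv v1 claim whose certificate is not yet released, so it is NOT vendored as
a fact here), the exact hypothesis the new record needs in each currency, so that a released and
re-certified solution discharges it in one line:

* `dupontEtAl2026_omega_le_of_cw5Certificate_row` — a `CW_5` degeneration certificate for the single
  row `(1, 2.371177)` gives `ω(ℂ) ≤ 2.371177` (the certificate predicate quantifies over the power `N`,
  so the higher analysis level `ℓ* = 4` needs no new vocabulary);
* `dupontEtAl2026_omega_le_of_forall_polyDegeneratesTo` — the square-shape form: degenerations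
  `⟨M⟩ ⊗ CW_5^{⊗N} ⊵ ⟨t⟩ ⊗ ⟨m,m,m⟩` with `M · 7^N ≤ t · m^{2.371177+δ}` for every `δ > 0`;
* `forall_polyDegeneratesTo_square_of_cw5Certificate_row_2371177` — the single-row certificate
  supplies those degenerations (restrict `⟨a, B, a⟩`, `B ≥ a`, to `⟨a, a, a⟩`);
* `advxxz2025_omega_le_of_omega_le_2371177` — the announced bound implies the refereed record
  `advxxz2025_omega_le` (`2.371177 ≤ 2.371339`).

## References

* E. Dupont et al., *Improving the matrix multiplication exponent with modern optimization and
  AlphaEvolve*, arXiv:2608.16884v1, 2026: abstract and Table 1 (p. 1); §2.4 eq. (11) and Thm. 1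
  (p. 8); §3 (`q = 5`, `ℓ* = 4`, p. 9); §4 (exact verification, repository pending, p. 10); §5
  (p. 10). [DupontEtAl2026]
* J. Alman, R. Duan, V. Vassilevska Williams, Y. Xu, Z. Xu, R. Zhou, *More asymmetry yields faster
  matrix multiplication*, SODA 2025, arXiv:2404.16349: §3.2–§3.6, §7 (procedure of degeneration and
  its limiting condition). [AlmanDuanVassilevskaWilliamsXuXuZhou2025]

## Status note (freshness, 2026-08-20)

arXiv:2404.16349 **v3** (posted 2026-08-19; "45 pages, in SODA 2025") of the Alman et al. paper now
prints the `k = 1` entry of its Table 1 as "`2.371177`†" with the caption "The stated bound for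
`k = 1` (†) is obtained in [DEK+26] by finding parameters for our analysis on the eighth power of the
CW tensor (the parameters found in this paper for the fourth power give `ω < 2.371339` instead). All
other stated bounds in the table are obtained by analyzing the fourth power", and its §8 adds
"[DEK+26] apply modern optimization and machine learning techniques to the optimization problem …
scaling the analysis up to the eighth power of the CW tensor; the resulting parameters, substituted
into the same analysis, yield `ω < 2.371177`."  The twelve rectangular rows (`k ≠ 1`) and
`μ < 0.5275` are unchanged; no bound on `α` is given in either text.  This confirms the reading above
(`q = 5`, `ℓ* = 4`, i.e. `CW_5^{⊗8}`, same analysis) and changes nothing here: the parameters and the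
verification code are still unreleased (arXiv:2608.16884 is v1 only as of 2026-08-20), so the bound
stays in hypothesis form; the refereed record vendored in `RectangularExponent.lean`
(`advxxz2025Table`, SODA 2025 as published) keeps `(1.00, 2.371339)`.
-/

noncomputable section

namespace Literature.Computability.AlgebraicComplexity

open Literature.Barriers.MatrixMultiplication

/-! ## The single certificate row behind the announced record -/

/-- **The announced record from its own row**: a `CW_5` degeneration certificate for the single row
`(1, 2.371177)` — the combination-loss laser method at a feasible point of program (11) with
`Ω = 2.371177` (`q = 5`, `ℓ* = 4`) — gives `ω ≤ 2.371177` over `ℂ`, by `R̃(CW_5) ≤ 7`, Schönhage's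
asymptotic sum inequality (`omegaRect_le_of_cw5DegenerationCertificate`) and `ω(1,1,1) = ω`.
Hypothesis form: the certificate itself is announced (arXiv v1), not released.
[cite: DupontEtAl2026, abstract p. 1; §2.4 eq. (11) and Thm. 1 p. 8; §4 p. 10] -/
theorem dupontEtAl2026_omega_le_of_cw5Certificate_row
    (h : CW5DegenerationCertificate [((1 : ℝ), (2.371177 : ℝ))]) : omega ℂ ≤ 2.371177 := by
  have h1 : omegaRect ℂ 1 1 1 ≤ 2.371177 :=
    omegaRect_le_of_cw5DegenerationCertificate h (by simp) zero_le_one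
  rwa [omegaRect_one_one_one] at h1

/-! ## The square-shape form -/

/-- **Square-shape degenerations give the announced record**: if for every `δ > 0` some
`⟨M⟩ ⊗ CW_5^{⊗N}` degenerates over `ℂ[λ]` into `⟨t⟩ ⊗ ⟨m, m, m⟩`, `t ≥ 1`, `m ≥ 2`, with
`M · 7^N ≤ t · m^{2.371177+δ}`, then `ω ≤ 2.371177` — the proved assembly
`omega_le_of_forall_polyDegeneratesTo` at `q = 5`, `(5 : ℝ) + 2 = 7`.
[cite: DupontEtAl2026, §2.4 eq. (11) and Thm. 1 p. 8] -/
theorem dupontEtAl2026_omega_le_of_forall_polyDegeneratesTo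
    (h : ∀ δ : ℝ, 0 < δ → ∃ t m M N : ℕ, 1 ≤ t ∧ 2 ≤ m ∧
      PolyDegeneratesTo (kroneckerTensor (unitTensor ℂ M) (kroneckerPow (bigCwTensor ℂ 5) N))
        (kroneckerTensor (unitTensor ℂ t) (matMulTensor ℂ m m m)) ∧
      (M : ℝ) * 7 ^ N ≤ (t : ℝ) * (m : ℝ) ^ ((2.371177 : ℝ) + δ)) :
    omega ℂ ≤ 2.371177 := by
  refine omega_le_of_forall_polyDegeneratesTo ℂ (q := 5) fun δ hδ => ?_
  obtain ⟨t, m, M, N, ht, hm, hdeg, hcount⟩ := h δ hδ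
  refine ⟨t, m, M, N, ht, hm, hdeg, ?_⟩
  have h7 : ((5 : ℕ) : ℝ) + 2 = 7 := by norm_num
  rw [h7]
  exact hcount

/-- The single-row certificate supplies the square-shape degenerations: restrict `⟨a, B, a⟩`
(`B ≥ a^1 = a`) to `⟨a, a, a⟩` (zeroing out columns is a restriction, hence a degeneration).
[cite: AlmanDuanVassilevskaWilliamsXuXuZhou2025, §3.2–§3.3 (restriction ⊆ degeneration)]
[cite: DupontEtAl2026, §2.4 Thm. 1 p. 8] -/
theorem forall_polyDegeneratesTo_square_of_cw5Certificate_row_2371177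
    (h : CW5DegenerationCertificate [((1 : ℝ), (2.371177 : ℝ))]) :
    ∀ δ : ℝ, 0 < δ → ∃ t m M N : ℕ, 1 ≤ t ∧ 2 ≤ m ∧
      PolyDegeneratesTo (kroneckerTensor (unitTensor ℂ M) (kroneckerPow (bigCwTensor ℂ 5) N))
        (kroneckerTensor (unitTensor ℂ t) (matMulTensor ℂ m m m)) ∧
      (M : ℝ) * 7 ^ N ≤ (t : ℝ) * (m : ℝ) ^ ((2.371177 : ℝ) + δ) := by
  intro δ hδ
  obtain ⟨N, t, V, a, B, -, -, hV, ha, haB, hdeg, hnum⟩ := h 1 2.371177 (by simp) δ hδ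
  have haB' : a ≤ B := by
    rw [Real.rpow_one] at haB
    exact_mod_cast haB
  refine ⟨V, a, t, N, hV, ha, hdeg.trans_restrictsTo ?_, hnum⟩
  classical
  exact (TensorRestrictsTo.refl (unitTensor ℂ V)).kronecker
    (tensorRestrictsTo_matMulTensor_of_le ℂ le_rfl haB' le_rfl)

/-! ## Monotonicity: the announced bound implies the refereed record -/

/-- `ω ≤ 2.371177` implies the SODA 2025 record `advxxz2025_omega_le : ω ≤ 2.371339`
(Table 1 of the note, p. 1: 2.371339 → 2.371177). [cite: DupontEtAl2026, Table 1 p. 1] -/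
theorem advxxz2025_omega_le_of_omega_le_2371177 (h : omega ℂ ≤ 2.371177) :
    advxxz2025_omega_le := by
  unfold advxxz2025_omega_le
  exact le_trans (α := ℝ) h (by norm_num)

end Literature.Computability.AlgebraicComplexity

end
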